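import Summits.NavierStokesRegularity.NavierStokesRegularity.Theorems.GaldiLiouvilleGateRecordZoomAncientStubZoomLimit
import Literature.Analysis.FluidPDE.OseenMildHolder
import HarnessLib

/-!
# Route `GaldiLiouvilleGate`, crux `RecordZoomAncient` (stmt-NavierStokesRegularity-0894),
  line `registered` (birth skeleton, reshape r7) — stub `stub_zoomNondegenerate`
  (near-maximal velocity persists backwards for a universal number of viscous times)

**Statement.** For every `θ > 0` there is a universal `s₁ ∈ [−1, 0)` such that: for a classical
solution `(u, p)` of the unforced Navier–Stokes system (viscosity `ν`) on `ℝ³ × [0, T)`,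
Leray–Hopf from `u 0`, a time `tc ∈ (0, T)` with `tc ≥ 3ν/M²`, a point `xc` and a level `M > 0`
dominating `‖u‖` on `[0, tc] × ℝ³`, if `‖u(tc, xc)‖ ≥ θ M` then `‖u(tc + ν s₁/M², xc)‖ ≥ θ M/2`.

**Proof (KNSS 2009, the uniform `1/4`-Hölder modulus of bounded Oseen-mild fields).** Let `K₀`
be the constant of `exists_holder_quarter_of_oseenMild` and `s₁ = −min 1 (θ/(4K₀))⁴`. The
velocity-normalised zoom `z(s, y) = M⁻¹ u(tc + ν s/M², xc + ν y/M)` is `α • stPull β γ tc xc u`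
with `α = M⁻¹`, `γ = ν/M`, `β = α γ = ν/M²`, hence (`IsClassicalNSSolutionOn.stRescale`) a
classical solution with viscosity `α ν/γ = 1` on the window `(A, b)`, `A = −tc M²/ν ≤ −3`,
`b = (T − tc) M²/ν > 0`; on `(A, 0]` it is bounded by `1` and has `L²`-bounded slices
(Leray–Hopf energy bound and the change of variables `eLpNorm_comp_space_affine`), so it is
Oseen-mild there (`mild_of_bounded_of_eLpNorm_two_le_of_lt`). The modulus on `[−2, b']`,
`b' ∈ [s₁, 0)`, gives `‖z(b', 0) − z(s₁, 0)‖ ≤ 2K₀ |b' − s₁|^{1/4} ≤ 2K₀ |s₁|^{1/4} ≤ θ/2`;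
letting `b' → 0⁻` (continuity of the time line of the classical solution `z` at `0 ∈ (A, b)`)
yields `‖z(0, 0) − z(s₁, 0)‖ ≤ θ/2`, and `‖z(0, 0)‖ = M⁻¹‖u(tc, xc)‖ ≥ θ` gives
`‖z(s₁, 0)‖ ≥ θ/2`, i.e. `‖u(tc + ν s₁/M², xc)‖ ≥ θ M/2`.

Sources: G. Koch, N. Nadirashvili, G. Seregin, V. Šverák, Acta Math. 203 (2009) =
arXiv:0709.3599, §4 Lemma 4.1, §6 Lemma 6.1 and (6.2).
-/

noncomputable section

open Set MeasureTheory Filter Topology Function Literature.Analysis.FluidPDE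
open scoped ENNReal NNReal

namespace Summit.NavierStokesRegularity.NavierStokesRegularity.Theorems.RecordZoomAncient.Birth

-- the problem-side namespace `Summit.NavierStokesRegularity.NavierStokesRegularity.…` (summit =
-- problem for this single-problem summit) duplicates `NavierStokesRegularity` by design
set_option linter.dupNamespace false

/-- **Stub `stub_zoomNondegenerate` (r7, S3): KNSS's uniform `1/4`-Hölder modulus in viscous
units.** For every `θ > 0` there is a universal `s₁ ∈ [−1, 0)` such that: for a classical
solution `(u, p)` on `ℝ³ × [0, T)`, Leray–Hopf from `u 0`, a time `tc ∈ (0, T)` with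
`tc ≥ 3ν/M²`, a point `xc` and a level `M > 0` dominating `‖u‖` on `[0, tc] × ℝ³`, if
`‖u(tc, xc)‖ ≥ θ M` then `‖u(tc + ν s₁/M², xc)‖ ≥ θ M/2` (proof in the module docstring). -/
theorem stub_zoomNondegenerate :
    ∀ θ : ℝ, 0 < θ → ∃ s₁ : ℝ, s₁ < 0 ∧ -1 ≤ s₁ ∧
      ∀ (ν T : ℝ), 0 < ν → 0 < T →
        ∀ (u : ℝ → EuclideanSpace ℝ (Fin 3) → EuclideanSpace ℝ (Fin 3)) (p : ℝ → EuclideanSpace ℝ (Fin 3) → ℝ),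
          IsClassicalNSSolutionOn (Set.Ico 0 T) ν 0 u p → IsLerayHopfOn T ν 0 (u 0) u →
          ∀ (tc : ℝ) (xc : EuclideanSpace ℝ (Fin 3)) (M : ℝ), 0 < tc → tc < T → 0 < M →
            3 * (ν / M ^ 2) ≤ tc →
            (∀ t ∈ Set.Icc 0 tc, ∀ x, ‖u t x‖ ≤ M) →
            θ * M ≤ ‖u tc xc‖ →
            θ / 2 * M ≤ ‖u (tc + ν / M ^ 2 * s₁) xc‖ := by
  intro θ hθ
  -- ### the universal Hölder constant and the choice of `s₁ = -δ`
  obtain ⟨K₀, hK₀, hHold⟩ := exists_holder_quarter_of_oseenMild (E := EuclideanSpace ℝ (Fin 3))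
  obtain ⟨c, hc⟩ : ∃ c : ℝ, c = θ / (4 * K₀) := ⟨_, rfl⟩
  have hcpos : 0 < c := hc ▸ div_pos hθ (by positivity)
  obtain ⟨δ, hδ⟩ : ∃ δ : ℝ, δ = min 1 (c ^ 4) := ⟨_, rfl⟩
  have hδpos : 0 < δ := hδ ▸ lt_min one_pos (pow_pos hcpos 4)
  have hδ1 : δ ≤ 1 := hδ ▸ min_le_left _ _
  have hδc : δ ^ (1 / 4 : ℝ) ≤ c := by
    calc δ ^ (1 / 4 : ℝ) ≤ (c ^ 4) ^ (1 / 4 : ℝ) :=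
          Real.rpow_le_rpow hδpos.le (hδ ▸ min_le_right _ _) (by norm_num)
      _ = c := by
          rw [show (1 / 4 : ℝ) = ((4 : ℕ) : ℝ)⁻¹ by norm_num]
          exact Real.pow_rpow_inv_natCast hcpos.le four_ne_zero
  have hKδ : K₀ * (1 + 1 ^ 2) * δ ^ (1 / 4 : ℝ) ≤ θ / 2 := by
    have h1 : K₀ * (1 + 1 ^ 2) * δ ^ (1 / 4 : ℝ) ≤ K₀ * (1 + 1 ^ 2) * c :=
      mul_le_mul_of_nonneg_left hδc (by positivity)
    have h2 : K₀ * (1 + 1 ^ 2) * c = θ / 2 := by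
      rw [hc]
      field_simp
      ring
    linarith
  refine ⟨-δ, by linarith, by linarith, ?_⟩
  intro ν T hν hT u p hcl hLH tc xc M htc htcT hM h3 hdom hvel
  -- ### scales `α = M⁻¹`, `γ = ν/M`, `β = α γ = ν/M²` (viscosity `α ν/γ = 1`), window `(A, b)`
  have hαpos : 0 < M⁻¹ := inv_pos.2 hM
  have hγpos : 0 < ν / M := div_pos hν hM
  have hβpos : 0 < ν / M ^ 2 := div_pos hν (pow_pos hM 2)
  obtain ⟨A, hA⟩ : ∃ A : ℝ, A = -(tc * M ^ 2 / ν) := ⟨_, rfl⟩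
  obtain ⟨b, hb⟩ : ∃ b : ℝ, b = (T - tc) * M ^ 2 / ν := ⟨_, rfl⟩
  have halg : ∀ s, ν / M ^ 2 = M⁻¹ * (ν / M) ∧ M⁻¹ * ν / (ν / M) = 1 ∧
      tc + ν / M ^ 2 * s = ν / M ^ 2 * (s - A) ∧
      T - (tc + ν / M ^ 2 * s) = ν / M ^ 2 * (b - s) ∧ tc = ν / M ^ 2 * (-A) := by
    intro s
    have hM0 : M ≠ 0 := hM.ne'
    have hν0 : ν ≠ 0 := hν.ne'
    rw [hA, hb]
    refine ⟨?_, ?_, ?_, ?_, ?_⟩ <;> field_simp <;> ring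
  have hA3 : A ≤ -3 := by
    obtain ⟨-, -, -, -, htcA⟩ := halg 0
    rw [htcA] at h3
    nlinarith
  have hbpos : 0 < b :=
    hb ▸ div_pos (mul_pos (sub_pos.2 htcT) (pow_pos hM 2)) hν
  -- original times of rescaled times
  have hmem_Ico : ∀ s, A < s → s < b → tc + ν / M ^ 2 * s ∈ Ico 0 T := by
    intro s h1 h2
    obtain ⟨-, -, hoA, hob, -⟩ := halg s
    have h3' : 0 < ν / M ^ 2 * (s - A) := mul_pos hβpos (by linarith)
    have h4 : 0 < ν / M ^ 2 * (b - s) := mul_pos hβpos (by linarith)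
    constructor <;> linarith
  have hmem_Icc : ∀ s, A < s → s ≤ 0 → tc + ν / M ^ 2 * s ∈ Icc 0 tc := by
    intro s h1 h2
    obtain ⟨-, -, hoA, -, -⟩ := halg s
    have h3' : 0 ≤ ν / M ^ 2 * (s - A) := mul_nonneg hβpos.le (by linarith)
    have h4 : ν / M ^ 2 * s ≤ 0 := mul_nonpos_of_nonneg_of_nonpos hβpos.le h2
    constructor <;> linarith
  -- ### the zoom: a classical solution with viscosity `1` on `(A, b)`, bounded by `1` on `(A, 0]`
  obtain ⟨z, hz⟩ : ∃ z : ℝ → EuclideanSpace ℝ (Fin 3) → EuclideanSpace ℝ (Fin 3),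
      z = M⁻¹ • stPull (ν / M ^ 2) (ν / M) tc xc u := ⟨_, rfl⟩
  have hz_apply : ∀ s y, z s y = M⁻¹ • u (tc + ν / M ^ 2 * s) (xc + (ν / M) • y) :=
    fun s y => by rw [hz]; rfl
  have hzslice : ∀ s, z s = M⁻¹ • fun y => u (tc + ν / M ^ 2 * s) (xc + (ν / M) • y) :=
    fun s => by rw [hz]; rfl
  have hclz : IsClassicalNSSolutionOn (Ioo A b) 1 0 z
      ((M⁻¹) ^ 2 • stPull (ν / M ^ 2) (ν / M) tc xc p) := by
    obtain ⟨hβeq, hvisc, -⟩ := halg 0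
    have h := hcl.stRescale hαpos hγpos hβeq tc xc
    rw [smul_stPull_zero, hvisc, ← hz] at h
    exact h.mono (fun s hs => hmem_Ico s hs.1 hs.2) (uniqueDiffOn_Ioo _ _)
  have hzb : ∀ s, A < s → s ≤ 0 → ∀ y, ‖z s y‖ ≤ 1 := by
    intro s h1 h2 y
    rw [hz_apply, norm_smul, norm_inv, Real.norm_of_nonneg hM.le, inv_mul_le_iff₀ hM, mul_one]
    exact hdom _ (hmem_Icc s h1 h2) _
  -- `L²` bounds of the zoom slices (Leray–Hopf energy bound and change of variables)
  obtain ⟨E2, hE2top, hE2⟩ : ∃ E2 : ℝ≥0∞, E2 ≠ ∞ ∧ ∀ t ∈ Icc 0 T, eLpNorm (u t) 2 volume ≤ E2 := by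
    refine ⟨ENNReal.ofReal (Real.sqrt (2 * VectorCalculus.kineticEnergy (u 0))),
      ENNReal.ofReal_ne_top, fun t ht => (ENNReal.pow_le_pow_left_iff two_ne_zero).1 ?_⟩
    rw [eLpNorm_two_sq_eq_lintegral, ← ENNReal.ofReal_pow (Real.sqrt_nonneg _),
      Real.sq_sqrt (mul_nonneg zero_le_two (kineticEnergy_nonneg _))]
    exact hLH.lintegral_enorm_sq_le hν.le ht
  obtain ⟨K, hKtop, hK⟩ : ∃ K : ℝ≥0∞, K ≠ ∞ ∧ ∀ s, A < s → s ≤ 0 → eLpNorm (z s) 2 volume ≤ K := by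
    refine ⟨‖M⁻¹‖ₑ *
      (ENNReal.ofReal ((ν / M) ^ Module.finrank ℝ (EuclideanSpace ℝ (Fin 3)))⁻¹ ^
        (1 / (2 : ℝ≥0∞)).toReal * E2), ?_, fun s h1 h2 => ?_⟩
    · exact ENNReal.mul_ne_top enorm_ne_top (ENNReal.mul_ne_top
        (ENNReal.rpow_ne_top_of_nonneg ENNReal.toReal_nonneg ENNReal.ofReal_ne_top) hE2top)
    · rw [hzslice s, eLpNorm_const_smul, eLpNorm_comp_space_affine hγpos xc _ 2]
      gcongr
      exact hE2 _ ⟨(hmem_Icc s h1 h2).1, (hmem_Icc s h1 h2).2.trans htcT.le⟩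
  -- the Oseen identity of the zoom between negative times of its bounded region
  have hmildz : ∀ s t : ℝ, A < s → s < t → t < 0 → ∀ x,
      z t x = Literature.Analysis.UnboundedOperators.heatExtension (z s) (t - s) x -
        oseenDuhamel 1 s z z t x :=
    fun s t h1 h2 h3' x =>
      mild_of_bounded_of_eLpNorm_two_le_of_lt hclz (h1.trans (h2.trans h3')) hbpos
        (fun τ hτ y => hzb τ hτ.1 hτ.2 y) hKtop (fun τ hτ => hK τ hτ.1 hτ.2) h1 h2 h3' x
  -- ### the Hölder modulus on `[-2, b']`, `b' ∈ [-δ, 0)`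
  have hholder : ∀ b' : ℝ, -δ ≤ b' → b' < 0 → ‖z b' 0 - z (-δ) 0‖ ≤ θ / 2 := by
    intro b' h1 h2
    have hcont : ∀ t ∈ Icc (-2 : ℝ) b', Continuous (z t) := fun t ht =>
      (hclz.contDiff_velocity ⟨by linarith [ht.1], by linarith [ht.2]⟩).continuous
    have hbd : ∀ t ∈ Icc (-2 : ℝ) b', ∀ x, ‖z t x‖ ≤ 1 := fun t ht x =>
      hzb t (by linarith [ht.1]) (by linarith [ht.2]) x
    have hmild' : ∀ s t : ℝ, -2 ≤ s → s < t → t ≤ b' → ∀ x,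
        z t x = Literature.Analysis.UnboundedOperators.heatExtension (z s) (t - s) x -
          oseenDuhamel 1 s z z t x :=
      fun s t hs hst ht x => hmildz s t (by linarith) hst (by linarith) x
    have h := hHold zero_le_one hcont hbd hmild' (-δ) ⟨by linarith, h1⟩ b' ⟨by linarith, le_rfl⟩
      0 0
    rw [sub_self, norm_zero, max_eq_left (abs_nonneg _)] at h
    calc ‖z b' 0 - z (-δ) 0‖ ≤ K₀ * (1 + 1 ^ 2) * |b' - -δ| ^ (1 / 4 : ℝ) := h
      _ ≤ K₀ * (1 + 1 ^ 2) * δ ^ (1 / 4 : ℝ) := by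
          refine mul_le_mul_of_nonneg_left (Real.rpow_le_rpow (abs_nonneg _) ?_ (by norm_num))
            (by positivity)
          rw [abs_le]
          constructor <;> linarith
      _ ≤ θ / 2 := hKδ
  -- ### the limit `b' → 0⁻` (continuity of the time line of `z` at `0 ∈ (A, b)`)
  have hcont0 : ContinuousAt (fun s => z s 0) 0 := by
    have h1 : ContinuousAt (uncurry z) ((0 : ℝ), (0 : EuclideanSpace ℝ (Fin 3))) :=
      hclz.smooth_velocity.continuousOn.continuousAt
        (prod_mem_nhds (Ioo_mem_nhds (by linarith) hbpos) univ_mem)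
    have h2 : ContinuousAt (fun s : ℝ => (s, (0 : EuclideanSpace ℝ (Fin 3)))) 0 :=
      (continuous_id.prodMk continuous_const).continuousAt
    have h3 : ContinuousAt (uncurry z ∘ fun s : ℝ => (s, (0 : EuclideanSpace ℝ (Fin 3)))) 0 :=
      h1.comp_of_eq h2 rfl
    exact h3
  have htend : Tendsto (fun s => ‖z s 0 - z (-δ) 0‖) (𝓝[<] 0) (𝓝 ‖z 0 0 - z (-δ) 0‖) :=
    ((hcont0.tendsto.sub_const _).norm).mono_left nhdsWithin_le_nhds
  have hev : ∀ᶠ s in 𝓝[<] (0 : ℝ), ‖z s 0 - z (-δ) 0‖ ≤ θ / 2 := by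
    filter_upwards [Ico_mem_nhdsLT (show -δ < 0 by linarith)] with s hs
    exact hholder s hs.1 hs.2
  have hlim : ‖z 0 0 - z (-δ) 0‖ ≤ θ / 2 := le_of_tendsto htend hev
  -- ### conclusion
  have hz0 : ‖z 0 0‖ = M⁻¹ * ‖u tc xc‖ := by
    rw [hz_apply, mul_zero, add_zero, smul_zero, add_zero, norm_smul, norm_inv,
      Real.norm_of_nonneg hM.le]
  have hz1 : ‖z (-δ) 0‖ = M⁻¹ * ‖u (tc + ν / M ^ 2 * -δ) xc‖ := by
    rw [hz_apply, smul_zero, add_zero, norm_smul, norm_inv, Real.norm_of_nonneg hM.le]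
  have hθ0 : θ ≤ ‖z 0 0‖ := by
    rw [hz0, ← div_eq_inv_mul, le_div_iff₀ hM]
    exact hvel
  have htri : ‖z 0 0‖ - ‖z (-δ) 0‖ ≤ ‖z 0 0 - z (-δ) 0‖ := norm_sub_norm_le _ _
  have hfin : θ / 2 ≤ M⁻¹ * ‖u (tc + ν / M ^ 2 * -δ) xc‖ := by
    rw [← hz1]
    linarith
  rwa [← div_eq_inv_mul, le_div_iff₀ hM] at hfin

end Summit.NavierStokesRegularity.NavierStokesRegularity.Theorems.RecordZoomAncient.Birth

end
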